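import Summits.BirchSwinnertonDyer.BirchSwinnertonDyer.Theorems.ThetaPartnerAtTwoMazurTateCongruenceAtTwoRPlusLineThreeFacts
import Literature.NumberTheory.EllipticCurves.Greenberg1999.TwoTorsionMuInvariant
import HarnessLib

/-!
# Crux C1 `MainConjectureTransportAlignedAtTwo` (stmt-BirchSwinnertonDyer-22296), line `birth`: the GALOIS SIDE of Buzzard's
# mod-`2` multiplicity one for an `S₃`-curve whose discriminant is NOT a `2`-adic square (lead att-p1 g9; `--supports 22296`)

THEOREMS ONLY (no `def`, no `sorry`, no new named fact). BSD is not proved by this; C1 is not closed by this.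

Cell `bsd-wall` proved (`…ThetaPartnerAtTwoMazurTateCongruenceAtTwoRPlusLineThreeFacts`, §1–§3) that for a curve `W/ℚ` with GOOD
SUPERSINGULAR reduction at `2` the two Galois-side hypotheses of Buzzard 2000 Prop. 2.4 (`buzzard2000_multiplicityOne_gamma0`) hold at
every mod-`2` eigen-ideal of `W`: (I) `ρ̄_{W,2} ⊗ 𝔽̄₂` irreducible, (S) `ρ̄_{W,2}` non-scalar on every decomposition group above `2`.
`GoodSS W 2` enters there at exactly three places: `#E(ℚ)[2] = 1` and `Δ ∉ ℚ²` (for (I), through Dokchitser–Dokchitser clause (1),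
`hasSurjectiveModNGaloisRep_two_iff`), and `Δ_min ≡ 5 (mod 8)` (for (S): then `√Δ ∉ ℚ₂`, so a local Galois element moves
`δ = ∏_{i<j}(x_i − x_j)`, hence a `2`-torsion point). This file re-threads those theorems for the curves of crux C1 — good ORDINARY at `2`,
no rational `2`-torsion abscissa, `Δ` not a square — under the one extra LOCAL hypothesis that `Δ` is not a square in `ℚ₂`
(`∀ s : ℚ_[2], s² ≠ Δ`; for a good-ordinary `S₃` curve this says exactly that the `2`-division cubic does not split completely over
`ℚ₂`, i.e. `W` is OFF the Kilford stratum `F1Sign2.OnKilfordStratumAtTwo`, where Buzzard's hypothesis fails and mod-`2` multiplicity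
one is not known — Kilford 2002, Kilford–Wiese 2008):

* §1 `exists_apply_eq_of_noTwoTorsion_of_not_isSquare` — `ρ̄_{W,2}` is ONTO `GL₂(𝔽₂)` (Dokchitser–Dokchitser (1), tree theorem);
* §2 `exists_mem_decompositionSubgroup_apply_ne_one_of_not_padicSquare` — every `D_𝔓`, `𝔓 ∣ 2`, moves a `2`-torsion point;
* §3 `finrank_torsionBySet_eq_two_of_buzzard_S3` — `dim_{𝕋/𝔪} J₀(L)[𝔪] = 2` at every mod-`2` eigen-ideal of `W` of odd level `L`
  with good reduction off `2L`, from `buzzard2000_multiplicityOne_gamma0` ALONE (statement = bsd-wall's `…_of_buzzard` with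
  `GoodSS W 2` replaced by the three hypotheses above; proof verbatim otherwise).

References: Buzzard, MRL 7 (2000) Prop. 2.4 [Buzzard2000LevelLoweringModTwo]; Dokchitser–Dokchitser, Math. Z. 272 (2012) Thm (1)
[DokchitserDokchitserMathZ2012]; Neukirch ANT II (9.6) [NeukirchANT1999]; Kilford, JNT 97 (2002); Kilford–Wiese, Exp. Math. 17 (2008).
-/

noncomputable section

-- justification: the `Summit.BirchSwinnertonDyer.BirchSwinnertonDyer.…` path repeats a component (route-file convention)
set_option linter.dupNamespace false

open scoped MatrixGroups ModularForm NumberField Pointwise Classical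
open CongruenceSubgroup Polynomial IsDedekindDomain Field Matrix WeierstrassCurve
open Literature.NumberTheory.EllipticCurves Literature.NumberTheory.EllipticCurves.ModularForms
open Literature.NumberTheory.EllipticCurves.Greenberg1999
open Literature.NumberTheory.GaloisRepresentations Rat.HeightOneSpectrum
open Summit.BirchSwinnertonDyer.BirchSwinnertonDyer.Theorems.ThetaLayerLambdaCongruenceAtTwo

namespace Summit.BirchSwinnertonDyer.BirchSwinnertonDyer.Theorems.AlignedTransportAtTwoBuzzardGalois

/-! ## §1 (I) GLOBAL: `ρ̄_{W,2}` is onto `GL₂(𝔽₂)` for an `S₃`-curve -/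

/-- **No rational `2`-torsion abscissa ⇒ `2P = O ⇒ P = O` on `E(ℚ)`**: a rational `P ≠ O` with `2P = O` is `(x, y)` with `P = −P`,
i.e. `2y + a₁x + a₃ = 0`, i.e. `HasRationalTwoTorsionX W x` (same two lines as the cell's `…Closure.irr_two_of_forall_not_hasRationalTwoTorsionX`,
repeated here to keep this file outside the route cone). [cite: SilvermanAEC2009, III.2.3 (negation formula)] -/
theorem forall_two_nsmul_eq_zero_of_forall_not_hasRationalTwoTorsionX (W : WeierstrassCurve ℚ)
    (ht : ∀ x : ℚ, ¬ HasRationalTwoTorsionX W x) : ∀ P : W.toAffine.Point, 2 • P = 0 → P = 0 := by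
  intro P h2P
  rcases P with _ | ⟨x, y, h⟩
  · rfl
  · exfalso
    refine ht x ⟨y, ((Affine.nonsingular_iff' x y).mp h).1, ?_⟩
    have hneg : (Affine.Point.some x y h : W.toAffine.Point) = -(Affine.Point.some x y h) := by
      rw [← add_eq_zero_iff_eq_neg, ← two_nsmul]; exact h2P
    rw [Affine.Point.neg_some, Affine.Point.some.injEq] at hneg
    have hy : y = -y - W.a₁ * x - W.a₃ := hneg.2
    linear_combination hy

/-- **Every element of `GL₂(𝔽₂)` is a `ρ̄_{W,2}(σ)`** for `W/ℚ` elliptic WITHOUT rational `2`-torsion abscissa and with `Δ ∉ ℚ²`: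
`ρ̄_{W,2}` is onto `Aut(E[2])` by Dokchitser–Dokchitser clause (1) (tree theorem `hasSurjectiveModNGaloisRep_two_iff`), transported to the
frame of `ρ̄` (bsd-wall's `exists_apply_eq_of_goodSS_two` with its `GoodSS` input replaced by the two clauses it was used for).
[cite: DokchitserDokchitserMathZ2012, Theorem (1)] -/
theorem exists_apply_eq_of_noTwoTorsion_of_not_isSquare (W : WeierstrassCurve ℚ) [W.IsElliptic]
    (ht : ∀ x : ℚ, ¬ HasRationalTwoTorsionX W x) (hΔ : ¬ IsSquare W.Δ)
    {ρ : ModPGaloisRep ℚ (ZMod 2) 2} (hρ : W.IsTorsionGaloisRep 2 ρ) (g : GL (Fin 2) (ZMod 2)) :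
    ∃ σ : absoluteGaloisGroup ℚ, ρ σ = g := by
  have hsurj : W.HasSurjectiveModNGaloisRep 2 :=
    (hasSurjectiveModNGaloisRep_two_iff W).mpr ⟨forall_two_nsmul_eq_zero_of_forall_not_hasRationalTwoTorsionX W ht, hΔ⟩
  obtain ⟨e, he⟩ := hρ
  -- the additive automorphism of `E[2]` with matrix `g` in the frame `e`
  have hMiM : ((g⁻¹ : GL (Fin 2) (ZMod 2)) : Matrix (Fin 2) (Fin 2) (ZMod 2)) * (g : Matrix (Fin 2) (Fin 2) (ZMod 2)) = 1 :=
    Units.inv_mul g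
  have hMMi : (g : Matrix (Fin 2) (Fin 2) (ZMod 2)) * ((g⁻¹ : GL (Fin 2) (ZMod 2)) : Matrix (Fin 2) (Fin 2) (ZMod 2)) = 1 :=
    Units.mul_inv g
  let φ : geomTorsion W 2 ≃+ geomTorsion W 2 :=
    { toFun := fun P ↦ e.symm (Matrix.mulVec (g : Matrix (Fin 2) (Fin 2) (ZMod 2)) (e P))
      invFun := fun P ↦ e.symm (Matrix.mulVec ((g⁻¹ : GL (Fin 2) (ZMod 2)) : Matrix (Fin 2) (Fin 2) (ZMod 2)) (e P))
      left_inv := fun P ↦ by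
        dsimp only
        rw [AddEquiv.apply_symm_apply, Matrix.mulVec_mulVec, hMiM, Matrix.one_mulVec, AddEquiv.symm_apply_apply]
      right_inv := fun P ↦ by
        dsimp only
        rw [AddEquiv.apply_symm_apply, Matrix.mulVec_mulVec, hMMi, Matrix.one_mulVec, AddEquiv.symm_apply_apply]
      map_add' := fun P Q ↦ by
        rw [← map_add, ← Matrix.mulVec_add, ← map_add] }
  have hφ : ∀ P : geomTorsion W 2, e (φ P) = Matrix.mulVec (g : Matrix (Fin 2) (Fin 2) (ZMod 2)) (e P) := fun P ↦
    e.apply_symm_apply _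
  obtain ⟨σ, hσ⟩ := hsurj (Multiplicative.ofAdd φ)
  refine ⟨σ, ?_⟩
  have hσP : ∀ P : geomTorsion W 2, σ • P = φ P := fun P ↦ by
    rw [← galoisRepTorsion_apply W 2 σ P, hσ]; rfl
  have hv : ∀ w : Fin 2 → ZMod 2,
      Matrix.mulVec ((ρ σ : GL (Fin 2) (ZMod 2)) : Matrix (Fin 2) (Fin 2) (ZMod 2)) w =
        Matrix.mulVec (g : Matrix (Fin 2) (Fin 2) (ZMod 2)) w := fun w ↦ by
    obtain ⟨P, rfl⟩ := e.surjective w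
    rw [← he σ P, hσP, hφ]
  refine Matrix.GeneralLinearGroup.ext fun i j ↦ ?_
  have hij := congrFun (hv (Pi.single j 1)) i
  rwa [Matrix.mulVec_single_one, Matrix.mulVec_single_one] at hij

/-! ## §2 (S) LOCAL: if `Δ` is not a square in `ℚ₂`, every decomposition group above `2` moves a `2`-torsion point -/

/-- Transport of «`Δ` is not a square in `ℚ₂`» to `ℚ_[q]` for a prime `q` provably equal to `2` (the place `v ∣ 2` is referred
to through `primesEquiv v`). [folklore] -/
theorem not_sq_eq_padic_of_eq_two {D : ℚ} (hD : ∀ s : ℚ_[2], s ^ 2 ≠ (D : ℚ_[2])) {q : ℕ} [hq : Fact q.Prime] (hq2 : q = 2)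
    (s : ℚ_[q]) : s ^ 2 ≠ (D : ℚ_[q]) := by
  subst hq2
  exact hD s

/-- **If `Δ_W` is not a square in `ℚ₂`, the decomposition group of `𝔓_{ι,𝔐}` moves a `2`-torsion point**: for `W/ℚ` elliptic, the
framed `ρ̄ = ρ̄_{W,2}`, `v ∣ 2`, an embedding `ι : ℚ̄ → ℚ̄_v` and a prime `𝔐` of `\bar ℤ_v`, some `σ ∈ D_{𝔓_{ι,𝔐}}` has `ρ̄(σ) ≠ 1`.
PROOF (bsd-wall's `…_of_goodSS_two`, last step replaced): if `D_𝔓` fixed `E[2]` pointwise, every `τ ∈ Gal(ℚ̄₂/ℚ₂)` (restricting into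
`D_𝔓`, `resGalOfEmb_mem_decompositionSubgroup`) would fix `ι(δ)`, `δ = ∏_{i<j}(x_i − x_j)` (`smul_delta`), so `δ ∈ ℚ₂`
(`K̄_v^{Γ_{K_v}} = K_v`) and `Δ = 16δ² = (4δ)²` (`algebraMap_Δ`) would be a square in `ℚ₂`.
[cite: SilvermanAEC2009, III.§1 (Δ and the 2-division points)] [cite: NeukirchANT1999, Ch. II §9 Prop. (9.6)] -/
theorem exists_mem_decompositionSubgroup_primeBelow_apply_ne_one_of_not_padicSquare (W : WeierstrassCurve ℚ) [W.IsElliptic]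
    (hΔ₂ : ∀ s : ℚ_[2], s ^ 2 ≠ (W.Δ : ℚ_[2])) {ρ : ModPGaloisRep ℚ (ZMod 2) 2} (hρ : W.IsTorsionGaloisRep 2 ρ)
    {v : HeightOneSpectrum (𝓞 ℚ)} (hv : (primesEquiv v : ℕ) = 2)
    (ι : AlgebraicClosure ℚ →ₐ[ℚ] AlgebraicClosure (v.adicCompletion ℚ)) {𝔐 : Ideal (HeightOneSpectrum.localAbsIntegers v)}
    (h𝔐 : 𝔐 ∈ v.localPrimesAbove) :
    ∃ σ ∈ (v.primeBelow ι 𝔐).decompositionSubgroup (absoluteGaloisGroup ℚ), ρ σ ≠ 1 := by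
  have h2 : (2 : ℚ) ≠ 0 := two_ne_zero
  by_contra hall
  push Not at hall
  -- every `τ ∈ Gal(ℚ̄₂/ℚ₂)` fixes `E[2]` pointwise through `res_ι`
  obtain ⟨e, he⟩ := hρ
  have hfixP : ∀ (τ : absoluteGaloisGroup (v.adicCompletion ℚ)) (P : geomTorsion W 2), resGalOfEmb ι τ • P = P :=
      fun τ P ↦ by
    have hone := hall _ (resGalOfEmb_mem_decompositionSubgroup ι h𝔐 τ)
    apply e.injective
    rw [he, hone, Units.val_one, Matrix.one_mulVec]
  -- hence fixes `δ`
  have hδ : ∀ τ : absoluteGaloisGroup (v.adicCompletion ℚ), resGalOfEmb ι τ • DokchitserDokchitser2012.delta W h2 =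
      DokchitserDokchitser2012.delta W h2 := fun τ ↦ by
    have hperm : DokchitserDokchitser2012.permGal W h2 (resGalOfEmb ι τ) = 1 := by
      rw [← DokchitserDokchitser2012.permGal_one W h2]
      unfold DokchitserDokchitser2012.permGal
      congr 1
      ext P
      rw [DokchitserDokchitser2012.rho_apply, DokchitserDokchitser2012.rho_apply, one_smul, hfixP]
    rw [DokchitserDokchitser2012.smul_delta, hperm, Equiv.Perm.sign_one]; simp
  have hfix : ∀ τ : AlgebraicClosure (v.adicCompletion ℚ) ≃ₐ[v.adicCompletion ℚ] AlgebraicClosure (v.adicCompletion ℚ),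
      τ (ι (DokchitserDokchitser2012.delta W h2)) = ι (DokchitserDokchitser2012.delta W h2) := fun τ ↦ by
    have h := apply_resGalAuxOfEmb_apply ι τ (DokchitserDokchitser2012.delta W h2)
    rw [← resGalOfEmb_apply] at h
    change ι (resGalOfEmb ι τ • DokchitserDokchitser2012.delta W h2) = τ (ι (DokchitserDokchitser2012.delta W h2)) at h
    rw [hδ τ] at h
    exact h.symm
  -- so `ι δ ∈ ℚ_v` (no `CharZero` instance is introduced: it would switch the `ℚ`-algebra structure)
  haveI : PerfectField (v.adicCompletion ℚ) :=
    @PerfectField.ofCharZero _ _ (charZero_of_injective_algebraMap (algebraMap ℚ (v.adicCompletion ℚ)).injective)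
  haveI : IsGalois (v.adicCompletion ℚ) (AlgebraicClosure (v.adicCompletion ℚ)) := {}
  obtain ⟨r, hr⟩ := (InfiniteGalois.mem_range_algebraMap_iff_fixed (ι (DokchitserDokchitser2012.delta W h2))).mpr
    (fun τ ↦ hfix τ)
  -- `Δ = 16 δ²` read in `ℚ̄`, then in `ℚ̄_v`, then in `ℚ_v`
  have hΔbar : (W.Δ : AlgebraicClosure ℚ) = 16 * DokchitserDokchitser2012.delta W h2 ^ 2 := by
    rw [← DokchitserDokchitser2012.algebraMap_Δ W h2]; exact (eq_ratCast _ _).symm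
  have hsq : (W.Δ : v.adicCompletion ℚ) = 16 * r ^ 2 := by
    apply (algebraMap (v.adicCompletion ℚ) (AlgebraicClosure (v.adicCompletion ℚ))).injective
    have h1 : ι (W.Δ : AlgebraicClosure ℚ) = (W.Δ : AlgebraicClosure (v.adicCompletion ℚ)) :=
      map_ratCast (ι : AlgebraicClosure ℚ →+* AlgebraicClosure (v.adicCompletion ℚ)) W.Δ
    rw [map_ratCast, map_mul, map_pow, hr, map_ofNat, ← h1, hΔbar, map_mul, map_pow, map_ofNat]
  -- transport to `ℚ_[2]`: `Δ` would be the square `(4r)²` in `ℚ_[2]`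
  haveI : Fact (primesEquiv v : ℕ).Prime := ⟨(primesEquiv v).2⟩
  have hpad : (W.Δ : ℚ_[(primesEquiv v : ℕ)]) =
      16 * ((Rat.HeightOneSpectrum.adicCompletion.padicEquiv (R := 𝓞 ℚ) v).toAlgEquiv.toRingEquiv r) ^ 2 := by
    rw [← Literature.NumberTheory.QuadraticForms.padicEquiv_algebraMap_rat v W.Δ, eq_ratCast, hsq, map_mul, map_pow,
      map_ofNat]
  refine not_sq_eq_padic_of_eq_two hΔ₂ hv (4 * (adicCompletion.padicEquiv (R := 𝓞 ℚ) v).toAlgEquiv.toRingEquiv r) ?_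
  rw [hpad]
  ring

/-- **If `Δ_W` is not a square in `ℚ₂`, every decomposition group above `2` moves a `2`-torsion point** (the non-scalar hypothesis of
Buzzard's Prop. 2.4 for `ρ̄_{W,2}`): for the framed `ρ̄ = ρ̄_{W,2}`, `v ∣ 2` and any prime `𝔓 ∣ v` of `\bar ℤ`, some `σ ∈ D_𝔓` has
`ρ̄(σ) ≠ 1` — from the `𝔓_{ι,𝔐}` case by transitivity of `Γ_ℚ` on the primes above `v` (`exists_smul_eq_of_mem_primesAbove_holds`) and
`D_{g𝔓} = g D_𝔓 g⁻¹`. [cite: SilvermanAEC2009, III.§1 (Δ and the 2-division points)] [cite: NeukirchANT1999, Ch. I §9 (9.1), Ch. II §9 Prop. (9.6)] -/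
theorem exists_mem_decompositionSubgroup_apply_ne_one_of_not_padicSquare (W : WeierstrassCurve ℚ) [W.IsElliptic]
    (hΔ₂ : ∀ s : ℚ_[2], s ^ 2 ≠ (W.Δ : ℚ_[2])) {ρ : ModPGaloisRep ℚ (ZMod 2) 2} (hρ : W.IsTorsionGaloisRep 2 ρ)
    {v : HeightOneSpectrum (𝓞 ℚ)} (hv : (primesEquiv v : ℕ) = 2) {𝔓 : Ideal (absIntegers (𝓞 ℚ) ℚ)}
    (h𝔓 : 𝔓 ∈ v.primesAbove) :
    ∃ σ ∈ 𝔓.decompositionSubgroup (absoluteGaloisGroup ℚ), ρ σ ≠ 1 := by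
  obtain ⟨𝔐, h𝔐⟩ := v.localPrimesAbove_nonempty
  obtain ⟨g, hg⟩ := HeightOneSpectrum.exists_smul_eq_of_mem_primesAbove_holds
    (HeightOneSpectrum.primeBelow_mem_primesAbove (ι := closureEmb (K := ℚ) (v.adicCompletion ℚ)) h𝔐) h𝔓
  obtain ⟨σ₀, hσ₀, hne⟩ := exists_mem_decompositionSubgroup_primeBelow_apply_ne_one_of_not_padicSquare W hΔ₂ hρ hv
    (closureEmb (K := ℚ) (v.adicCompletion ℚ)) h𝔐
  refine ⟨g * σ₀ * g⁻¹, ?_, fun h ↦ hne ?_⟩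
  · rw [← hg, Ideal.decompositionSubgroup_smul]
    exact Subgroup.smul_mem_pointwise_smul _ _ _ hσ₀
  · rwa [map_mul, map_mul, map_inv, mul_inv_eq_one, mul_eq_left] at h

/-- **`Δ` not a square in `ℚ₂` ⇒ `Δ` not a square in `ℚ`.** [folklore] -/
theorem not_isSquare_Δ_of_not_padicSquare (W : WeierstrassCurve ℚ) (hΔ₂ : ∀ s : ℚ_[2], s ^ 2 ≠ (W.Δ : ℚ_[2])) :
    ¬ IsSquare W.Δ := by
  rintro ⟨s, hs⟩
  refine hΔ₂ (s : ℚ_[2]) ?_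
  rw [hs, sq]
  push_cast
  ring

/-! ## §3 Buzzard's mod-`2` multiplicity one at the eigen-ideal of an `S₃`-curve with `Δ ∉ ℚ₂²` -/

/-- **`dim_{𝕋/𝔪} J₀(L)[𝔪] = 2` at a mod-`2` eigen-ideal of an elliptic curve `W/ℚ` without rational `2`-torsion abscissa whose
discriminant is not a square in `ℚ₂`, from Buzzard's fact ALONE** (bsd-wall's `finrank_torsionBySet_eq_two_of_buzzard` with `GoodSS W 2`
replaced; statement otherwise verbatim). `L` odd; every prime `p ∤ 2L` good for `W`; `𝔪` a maximal ideal of `𝕋 = HeckeRing0 L 2` containing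
`2`, with `|𝕋/𝔪| = 2` and `T_q - a_q(W) ∈ 𝔪` for all primes `q ∤ L`. The hypotheses of `buzzard2000_multiplicityOne_gamma0` hold with
`k = 𝔽̄₂`, `ι : 𝕋/𝔪 ≅ 𝔽₂ → k`, `ρ = ρ̄_{W,2} ⊗ k`: (U) unramified with `charpoly ρ(Frob_p) = X² - ι(T_p) X + p` at `p ∤ 2L`; (I) irreducible
over `k` — `ρ̄_{W,2}` is ONTO `GL₂(𝔽₂)` (§1), so its image contains both transvections; (S) non-scalar on every `D_𝔓`, `𝔓 ∣ 2` (§2; over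
`𝔽₂` the only scalar in `GL₂` is `1`). [cite: Buzzard2000LevelLoweringModTwo, Prop. 2.4 and Def. 2.1–2.2 (p. 100–101)]
[cite: DokchitserDokchitserMathZ2012, Theorem (1)] -/
theorem finrank_torsionBySet_eq_two_of_buzzard_S3
    (hBz : buzzard2000_multiplicityOne_gamma0)
    (W : WeierstrassCurve ℚ) [W.IsElliptic] [W.IsGloballyMinimal]
    (ht : ∀ x : ℚ, ¬ HasRationalTwoTorsionX W x) (hΔ₂ : ∀ s : ℚ_[2], s ^ 2 ≠ (W.Δ : ℚ_[2]))
    (L : ℕ) [NeZero L] (hL : Odd L)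
    (hgood : ∀ v : HeightOneSpectrum (𝓞 ℚ), ¬ ((primesEquiv v : ℕ) ∣ 2 * L) → W.HasGoodReductionAt v)
    (𝔪 : Ideal (HeckeRing0 L 2)) (h𝔪 : 𝔪.IsMaximal) (h2 : (2 : HeckeRing0 L 2) ∈ 𝔪)
    (hq : Nat.card (HeckeRing0 L 2 ⧸ 𝔪) = 2)
    (hT : ∀ (q : ℕ) (hq : q.Prime), ¬ q ∣ L → HeckeRing0.T L 2 q hq - (W.LFunction q : HeckeRing0 L 2) ∈ 𝔪) :
    Module.finrank (HeckeRing0 L 2 ⧸ 𝔪) (Submodule.torsionBySet (HeckeRing0 L 2) (J0 L) 𝔪) = 2 := by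
  classical
  have hΔ : ¬ IsSquare W.Δ := not_isSquare_Δ_of_not_padicSquare W hΔ₂
  -- the coefficient field `k = 𝔽̄₂` (discrete) and `ι : 𝕋/𝔪 ≅ 𝔽₂ → k`
  let k : Type := AlgebraicClosure (ZMod 2)
  letI : TopologicalSpace k := ⊥
  haveI : DiscreteTopology k := ⟨rfl⟩
  haveI : Finite (HeckeRing0 L 2 ⧸ 𝔪) := Nat.finite_of_card_ne_zero (by rw [hq]; norm_num)
  letI : Fintype (HeckeRing0 L 2 ⧸ 𝔪) := Fintype.ofFinite _
  have hF : Fintype.card (HeckeRing0 L 2 ⧸ 𝔪) = 2 := by rw [Fintype.card_eq_nat_card, hq]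
  let e : ZMod 2 ≃+* HeckeRing0 L 2 ⧸ 𝔪 := ZMod.ringEquivOfPrime _ Nat.prime_two hF
  let f : ZMod 2 →+* k := algebraMap (ZMod 2) k
  let ι : HeckeRing0 L 2 ⧸ 𝔪 →+* k := f.comp e.symm.toRingHom
  have hι : ∀ a : ℤ, ι (Ideal.Quotient.mk 𝔪 (a : HeckeRing0 L 2)) = (a : k) := fun a ↦ by
    simp only [map_intCast]
  -- the mod-`2` representation of `W` and its base change to `k`
  obtain ⟨ρ₀, hρ₀⟩ := W.exists_isTorsionGaloisRep 2
  let ρ : ModPGaloisRep ℚ k 2 := FramedRep.baseChange f continuous_of_discreteTopology ρ₀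
  have hρapp : ∀ σ, ((ρ σ : GL (Fin 2) k) : Matrix (Fin 2) (Fin 2) k) =
      ((ρ₀ σ : GL (Fin 2) (ZMod 2)) : Matrix (Fin 2) (Fin 2) (ZMod 2)).map f := fun σ ↦ rfl
  refine hBz L hL 𝔪 h𝔪 h2 k ι ρ ?_ ?_ ?_
  · -- (U) unramified with the Eichler–Shimura characteristic polynomial at `p ∤ 2L`
    intro v hv
    have hp2 : ¬ ((primesEquiv v : Nat.Primes) : ℕ) ∣ 2 := fun h ↦ hv (h.mul_right L)
    have hpL : ¬ ((primesEquiv v : Nat.Primes) : ℕ) ∣ L := fun h ↦ hv (Dvd.dvd.mul_left h 2)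
    have hgoodv : W.HasGoodReductionAt v := hgood v hv
    have h2v : ((2 : ℕ) : 𝓞 ℚ) ∉ v.asIdeal := fun h ↦ hp2 ((natCast_mem_asIdeal_iff_primesEquiv_dvd v 2).mp h)
    refine ⟨?_, ?_⟩
    · intro 𝔓 h𝔓 σ hσ
      have h1 : ρ₀ σ = 1 := hρ₀.isUnramifiedAt_of_hasGoodReductionAt hgoodv h2v 𝔓 h𝔓 σ hσ
      change Matrix.GeneralLinearGroup.map f (ρ₀ σ) = 1
      rw [h1, map_one]
    · intro 𝔓 h𝔓 σ hσ
      have hc := hρ₀.charpoly_eq_of_isArithFrobAt (W.trace_galoisRepTate_frobenius_of_hasGoodReductionAt_holds 2)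
        (W.det_galoisRepTate_frobenius_of_hasGoodReductionAt_holds 2) h2v hgoodv h𝔓 hσ
      have hTp : ι (Ideal.Quotient.mk 𝔪 (HeckeRing0.T L 2 ((primesEquiv v : Nat.Primes) : ℕ) (primesEquiv v).2)) =
          ((W.frobeniusTraceAt v : ℤ) : k) := by
        have hmk : Ideal.Quotient.mk 𝔪 (HeckeRing0.T L 2 ((primesEquiv v : Nat.Primes) : ℕ) (primesEquiv v).2) =
            Ideal.Quotient.mk 𝔪 ((W.LFunction (primesEquiv v : ℕ) : ℤ) : HeckeRing0 L 2) := by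
          rw [Ideal.Quotient.mk_eq_mk_iff_sub_mem]
          exact hT _ (primesEquiv v).2 hpL
        rw [hmk, hι, W.lFunction_primesEquiv_eq_frobeniusTraceAt hgoodv]
      change (((ρ σ : GL (Fin 2) k) : Matrix (Fin 2) (Fin 2) k)).charpoly = _
      rw [hρapp, Matrix.charpoly_map, hc, hTp, natCard_residueField_adicCompletionIntegers v]
      simp only [Polynomial.map_add, Polynomial.map_sub, Polynomial.map_mul, Polynomial.map_pow, Polynomial.map_X,
        Polynomial.map_C]
      rw [map_intCast f, map_natCast f]
  · -- (I) irreducible over `k`: the image contains both transvections (§1: `ρ̄_{W,2}` is onto `GL₂(𝔽₂)`)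
    obtain ⟨T₁, hT₁⟩ := exists_GL_coe_eq_upperTransvection (ZMod 2)
    obtain ⟨T₂, hT₂⟩ := exists_GL_coe_eq_lowerTransvection (ZMod 2)
    obtain ⟨σ₁, h₁⟩ := exists_apply_eq_of_noTwoTorsion_of_not_isSquare W ht hΔ hρ₀ T₁
    obtain ⟨σ₂, h₂⟩ := exists_apply_eq_of_noTwoTorsion_of_not_isSquare W ht hΔ hρ₀ T₂
    have e₁ : ((ρ σ₁ : GL (Fin 2) k) : Matrix (Fin 2) (Fin 2) k) = !![(1 : k), 1; 0, 1] := by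
      rw [hρapp, h₁, hT₁, map_upperTransvection]
    have e₂ : ((ρ σ₂ : GL (Fin 2) k) : Matrix (Fin 2) (Fin 2) k) = !![(1 : k), 0; 1, 1] := by
      rw [hρapp, h₂, hT₂, map_lowerTransvection]
    refine isIrreducible_of_not_hasCommonEigenvector ρ.toMonoidHom ?_
    rintro ⟨w, hw0, hw⟩
    obtain ⟨a, ha⟩ := hw σ₁
    obtain ⟨b, hb⟩ := hw σ₂
    change ((ρ σ₁ : GL (Fin 2) k) : Matrix (Fin 2) (Fin 2) k) *ᵥ w = a • w at ha
    change ((ρ σ₂ : GL (Fin 2) k) : Matrix (Fin 2) (Fin 2) k) *ᵥ w = b • w at hb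
    rw [e₁] at ha
    rw [e₂] at hb
    exact hw0 (eq_zero_of_transvections_mulVec_eq_smul ha hb)
  · -- (S) non-scalar on the decomposition groups at `2` (§2; over `𝔽₂` the only scalar unit is `1`)
    intro v hv 𝔓 h𝔓
    obtain ⟨σ, hσ, hne⟩ := exists_mem_decompositionSubgroup_apply_ne_one_of_not_padicSquare W hΔ₂ hρ₀ hv h𝔓
    refine ⟨σ, hσ, fun c hc ↦ hne ?_⟩
    have hf : Function.Injective f := (algebraMap (ZMod 2) k).injective
    rw [hρapp] at hc
    have hent : ∀ i j, f (((ρ₀ σ : GL (Fin 2) (ZMod 2)) : Matrix (Fin 2) (Fin 2) (ZMod 2)) i j) =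
        Matrix.scalar (Fin 2) c i j := fun i j ↦ by
      rw [← hc]; rfl
    have h01 : ((ρ₀ σ : GL (Fin 2) (ZMod 2)) : Matrix (Fin 2) (Fin 2) (ZMod 2)) 0 1 = 0 :=
      hf (by rw [hent, map_zero]; simp)
    have h10 : ((ρ₀ σ : GL (Fin 2) (ZMod 2)) : Matrix (Fin 2) (Fin 2) (ZMod 2)) 1 0 = 0 :=
      hf (by rw [hent, map_zero]; simp)
    have hdet : IsUnit (((ρ₀ σ : GL (Fin 2) (ZMod 2)) : Matrix (Fin 2) (Fin 2) (ZMod 2)) 0 0 *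
        ((ρ₀ σ : GL (Fin 2) (ZMod 2)) : Matrix (Fin 2) (Fin 2) (ZMod 2)) 1 1) := by
      have h := (Matrix.isUnit_iff_isUnit_det _).mp (ρ₀ σ).isUnit
      rwa [Matrix.det_fin_two, h01, zero_mul, sub_zero] at h
    have hcases : ∀ x : ZMod 2, x ≠ 0 → x = 1 := by decide
    have h00 := hcases _ (IsUnit.mul_iff.mp hdet).1.ne_zero
    have h11 := hcases _ (IsUnit.mul_iff.mp hdet).2.ne_zero
    refine Matrix.GeneralLinearGroup.ext fun i j ↦ ?_
    rw [Units.val_one]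
    fin_cases i <;> fin_cases j
    · simpa using h00
    · simpa using h01
    · simpa using h10
    · simpa using h11

end Summit.BirchSwinnertonDyer.BirchSwinnertonDyer.Theorems.AlignedTransportAtTwoBuzzardGalois

end
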